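/-
Copyright: lit-balaban cell, Phase-2 proof seat p11 (gen 3).  Statement-level skeleton of a published paper; no proof claims beyond
what the kernel checks below.
-/
import Literature.MathematicalPhysics.QuantumFieldTheory.BalabanImbrieJaffe1984to88.BIJ85BlockAveragesTorusK

/-!
# `BalabanImbrieJaffe1984to88.BIJ85ScalarPropagatorTorusK` — T. Bałaban, J. Imbrie, A. Jaffe, *Renormalization of the Higgs model:
minimizers, propagators and the stability of mean field theory*, Commun. Math. Phys. **97** (1985) 299–329
[BalabanImbrieJaffe1985]: Sect. 4.6 p. 313 **(4.6.1)–(4.6.4) AT A GENERAL LEVEL `k`** ON THE TORUS CARRIER OF RECORD — the invertibility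
behind *"G_k(u_k) = [−Δ_{u_k} + a_kQ_k^*(u_k)Q_k(u_k)]^{−1} (4.6.2)"* PROVED for the `k`-level covariant average `Q_k(u)` (the `k`-fold
composition of (2.6) along the composite contours (5.1.2)–(5.1.3), `BIJ85BlockAveragesTorusK.qCovK`) and EVERY `U(1)` field `u`, and the
abstract theorems of `BIJ85Eq461Proof` (seat p30) / `BIJ85ScalarForm464` (seat p11) INSTANTIATED at level `k`

statement-level skeleton of published theorems with citation tags; proofs where landed; nothing here is a claim about the Yang–Mills mass gap

PDF held: `paper:balaban1985-cmp97-bij-higgs-minimizers` (journal page = PDF page + 298).  Pages read this session (`lit read`, OCR text):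
p. 302–303 [PDF 4–5], p. 309 [PDF 11], p. 313–314 [PDF 15–16].

CITATION HEADER (lean-in-tree rule).  Phase-2 file of the lit-balaban TYPED SKELETON (HOME `run/shared/lean/pub/lit-balaban/`), seat p11
gen 3 (unit `lit-balaban-p11-g3`; TAKING line HOME/STATUS.md 2026-08-21T05:02:42Z; owner r15, referee ref-5): the GENERAL-`k` torus MODEL
INSTANCE of rows **C1.Eq4.6.1** (`proved p245551`, p30 g2: (4.6.1) for `G = [D^*D + a_kQ^*Q]^{−1}` under the convergence hypothesis `hpos`)
and **C1.Eq4.6.2-4.6.4** (p248398, p11 g2: ψ_k/(3.28)/(4.6.4) over abstract carriers).  The gen-2 instance `BIJ85ScalarPropagatorTorus`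
(p248857) discharged `hpos` for ONE averaging level (`Q(u)` of (2.6)); this file does it for `Q_k(u)`, every `k` with `j + k ≤ m + K`.

THE PRINTED TEXT, verbatim (p. 313 [PDF 15]): *"The fundamental propagator G_k(u_k) for the scalar field in this theory can also be
defined by a functional integral, exp(½⟨h, G_k(u_k)h⟩) = Z_k(u_k)^{−1}∫𝒟φ exp[−½‖D_{u_k}φ‖² − ½a_k‖Q_k(u_k)φ‖² + ⟨φ, h⟩]. (4.6.1) Since no
restrictions on φ occur in the Gaussian integral (4.6.1), we can also write G_k(u_k) = [−Δ_{u_k} + a_kQ_k^*(u_k)Q_k(u_k)]^{−1}, (4.6.2)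
where −Δ_{u_k} = D^*_{u_k}D_{u_k}. (4.6.3) … Δ_k(u_k) = a_kI − a_k²Q_k(u_k)G_k(u_k)Q_k^*(u_k). (4.6.4) The scalar field action depends on the
unit lattice field ψ through the η-lattice minimizer ψ_k, where ψ_k = a_kG_k(u_k)Q_k^*(u_k)ψ."*; p. 309 [PDF 11] (for the gauge field):
*"Such zero modes do not occur … Similar, elementary reasoning yields an inductive proof for k > 1, but we leave out the details."*

WHAT IS PROVED HERE (theorems only; 0 `sorry`, standard axioms).  Carriers: `Balaban1983to89.Site P j` (the `η`-lattice, fine) and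
`Site P (j+k)` (the unit lattice), bonds `PBond P j`, `U : GaugeField P j U1` read in `ℂ` by `toC`, `BIJ88Sect3Statements.covD c (cfg U) φ b
= c(u_bφ(b₊) − φ(b₋))` (`c ≠ 0`), the `k`-level average `qCovK U k` / `QlinK U k` and the iterates `lineIter U i` = `u^{(i)}` of the sibling
`BIJ85BlockAveragesTorusK`; the one-level facts of `BIJ85ScalarPropagatorTorus` (gen 2) BY NAME.
* §1 TRANSPORT THROUGH THE LEVELS: if `D_uφ = 0` (`u_bφ(b₊) = φ(b₋)` on every bond) then `u(Γ_{yy′})φ(y′) = φ(y)` for the `L`-lattice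
  bonds read as runs (`lineU_mul_eq`: `D_{u^{(1)}}(φ∘corner) = 0`), hence inductively `D_{u^{(k)}}(Q_k(u)φ) = 0` on `T^{(j+k)}`
  (`transport_qCovK`) and `(Q_k(u)φ)(y) = φ(y)` with `y` read at its corner point (`qCovK_eq_cornerIter`); whence **NO ZERO MODES at
  level `k`**: `D_uφ = 0 ∧ Q_k(u)φ = 0 ⇒ φ = 0` for EVERY gauge field `u` and every `k` (`eq_zero_of_covD_eq_zero_of_qCovK_eq_zero`; the
  induction of p. 309 for the scalar average: `Q_{k+1}(u)φ = Q(u^{(k)})(Q_k(u)φ)` with `D_{u^{(k)}}(Q_k(u)φ) = 0`, so the one-level theorem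
  of gen 2 applies at level `j + k`).
* §2 **`hposK_torus`**: `φ ≠ 0 → 0 < ‖D_uφ‖² + a‖Q_k(u)φ‖²` (`a > 0`, `c ≠ 0`, `j + k ≤ m + K`) = the hypothesis `hpos` of
  `BIJ85Eq461Proof.exists_inverse`/`eq461` and of `BIJ85ScalarForm464.eq_phiCl_of_isMinOn` DISCHARGED at level `k`; whence, BY NAME:
  **`exists_GK`** ((4.6.2): `G_k(u) = [D_u^*D_u + aQ_k(u)^*Q_k(u)]^{−1}` exists as a two-sided inverse), **`eq461_torusK`** ((4.6.1) for the
  printed level-`k` exponent, no hypothesis left), **`isMinOn_psiK_torusK`** (ψ_k = aG_kQ_k(u)^*ψ is THE minimizer), **`eq328_torusK`**,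
  **`eq464_torusK`**/**`eq464_inf_torusK`** ((3.28) and the Gaussian form / infimum of (4.6.4) with the printed exponent), and at `k = 1` the
  gen-2 statements back (`exists_GK_one`).
* §3 **(6.3.2) for the scalar quadratic forms at level `k`** (row C1.Eq6.3.1-6.3.4, the sentence *"While we do not prove this invariance
  here, it is clear in the case of the quadratic forms for which we write explicit formulas"*): the exponent of (4.6.1)/(6.3.3) is invariant
  under `(u, φ, ψ) ↦ (u^h, hφ, hψ)` (`scalarForm_gaugeAct`, from (2.8)_k and `covD_gaugeAct`), hence **`⟨hψ, Δ_k(u^h)hψ⟩ = ⟨ψ, Δ_k(u)ψ⟩`**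
  (`inner_deltaOp_gaugeAct`, by the infimum characterization (4.6.4)) — every `u`, `h`, `a ≥ 0`, `j + k ≤ m + K`.
-/

open scoped RealInnerProductSpace BigOperators
open MeasureTheory Finset

namespace Literature.MathematicalPhysics.QuantumFieldTheory.BalabanImbrieJaffe1984to88.BIJ85ScalarPropagatorTorusK

open Literature.MathematicalPhysics.QuantumFieldTheory.Balaban1983to89
open BIJ88Sect3Statements (U1 toC cfg covD norm_toC)
open BIJ85Sect1Model (HiggsField)
open BIJ85BlockAveragesTorus BIJ85BlockAveragesTorusK BIJ85ScalarPropagatorTorus BIJ85ScalarForm464 BIJ85Eq461Proof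

noncomputable section

variable {P : Params} {j : ℕ}

/-! ## §1 Transport through the levels under `D_uφ = 0`; no zero modes at level `k` -/

/-- Transport along a straight run: if `u_bφ(b₊) = φ(b₋)` on every bond then `(Π_{t<n} u(b_t))·φ(x + ne_μ) = φ(x)` for the run bonds
`b_t = ⟨x + te_μ, x + (t+1)e_μ⟩` (consecutive, r18's `runBond_tgt`). [cite: BalabanImbrieJaffe1985, (2.5) p.302] -/
theorem prod_runBond_mul_eq {U : GaugeField P j U1} {φ : HiggsField P j}
    (hcov : ∀ b : PBond P j, toC (U b) * φ b.tgt = φ b.src) (x : Balaban1983to89.Site P j) (μ : Fin P.d) :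
    ∀ n : ℕ, (∏ t ∈ range n, toC (U (runBond x μ t))) * φ (runSite x μ n) = φ x
  | 0 => by rw [prod_range_zero, one_mul, runSite_zero]
  | n + 1 => by
    rw [prod_range_succ, mul_assoc, ← runBond_tgt x μ n, hcov (runBond x μ n)]
    exact prod_runBond_mul_eq hcov x μ n

/-- **`D_uφ = 0 ⇒ D_{u^{(1)}}(φ∘corner) = 0`**: `u(Γ_{yy′})φ(y′) = φ(y)` for every `L`-lattice bond `⟨y, y′⟩`, the corners read in the unit
lattice (`Γ_{yy′}` = the run of `L` unit bonds from corner to corner, r18's `corner_shift`; standing range). [cite: BalabanImbrieJaffe1985, (4.6.2) p.313] -/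
theorem lineU_mul_eq (hj : j + 1 ≤ P.m + P.K) {U : GaugeField P j U1} {φ : HiggsField P j}
    (hcov : ∀ b : PBond P j, toC (U b) * φ b.tgt = φ b.src) (c : PBond P (j+1)) :
    toC (lineU U c) * φ (corner c.tgt) = φ (corner c.src) := by
  rw [toC_lineU, runC, show c.tgt = c.src.shift c.dir from rfl, corner_shift hj]
  exact prod_runBond_mul_eq hcov _ _ P.L

/-- **The transport rule climbs the levels**: if `D_uφ = 0` then `D_{u^{(k)}}(Q_k(u)φ) = 0` on `T^{(j+k)}`, i.e.
`u^{(k)}_c·(Q_k(u)φ)(c₊) = (Q_k(u)φ)(c₋)` for every bond `c` of `T^{(j+k)}` (induction: `Q_{k+1}(u)φ = Q(u^{(k)})(Q_k(u)φ) = (Q_k(u)φ)∘corner`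
by gen 2's `qCov_eq_corner`, then `lineU_mul_eq`; standing range `j + k ≤ m + K`). [cite: BalabanImbrieJaffe1985, (4.6.2) p.313] -/
theorem transport_qCovK {U : GaugeField P j U1} {φ : HiggsField P j} (hcov : ∀ b : PBond P j, toC (U b) * φ b.tgt = φ b.src) :
    ∀ (k : ℕ), j + k ≤ P.m + P.K →
      ∀ c : PBond P (j+k), toC (lineIter U k c) * qCovK U k φ c.tgt = qCovK U k φ c.src
  | 0, _, c => hcov c
  | k + 1, hk, c => by
    have hk' : j + k + 1 ≤ P.m + P.K := by omega
    have ih := transport_qCovK hcov k (by omega)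
    have e : qCovK U (k+1) φ = fun y => qCovK U k φ (corner y) := funext fun y => qCov_eq_corner hk' ih y
    rw [e, lineIter_succ]
    exact lineU_mul_eq hk' ih c

/-- **`(Q_k(u)φ)(y) = φ(y)`**, `y ∈ T^{(j+k)}` read at its corner point in `T^{(j)}`, whenever `D_uφ = 0` (every term of the `k`-fold
average transports to the corner value; standing range). [cite: BalabanImbrieJaffe1985, (4.6.2) p.313] -/
theorem qCovK_eq_cornerIter {U : GaugeField P j U1} {φ : HiggsField P j} (hcov : ∀ b : PBond P j, toC (U b) * φ b.tgt = φ b.src) :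
    ∀ (k : ℕ), j + k ≤ P.m + P.K → ∀ y : Balaban1983to89.Site P (j+k), qCovK U k φ y = φ (cornerIter k y)
  | 0, _, _ => rfl
  | k + 1, hk, y => by
    have hk' : j + k + 1 ≤ P.m + P.K := by omega
    rw [qCovK_succ, qCov_eq_corner hk' (transport_qCovK hcov k (by omega)) y, cornerIter_succ]
    exact qCovK_eq_cornerIter hcov k (by omega) (corner y)

/-- **NO ZERO MODES of `−Δ_u + aQ_k(u)^*Q_k(u)` AT EVERY LEVEL `k`**: `D_uφ = 0` and `Q_k(u)φ = 0` force `φ = 0` — for EVERY `U(1)` gauge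
field `u` (no small-field or gauge condition; `c ≠ 0`, standing range `j + k ≤ m + K`).  The induction *"for k > 1"* of p. 309, for the
scalar average: `Q_{k+1}(u)φ = Q(u^{(k)})ψ` with `ψ = Q_k(u)φ`, `D_{u^{(k)}}ψ = 0` (`transport_qCovK`), so gen 2's one-level theorem
`eq_zero_of_covD_eq_zero_of_qCov_eq_zero` at level `j + k` gives `ψ = 0`, and the induction hypothesis gives `φ = 0`.  This is the
invertibility asserted in (4.6.2) at level `k`. [cite: BalabanImbrieJaffe1985, (4.6.2) p.313] -/
theorem eq_zero_of_covD_eq_zero_of_qCovK_eq_zero {c : ℝ} (hc : c ≠ 0) {U : GaugeField P j U1} {φ : HiggsField P j}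
    (hD : ∀ b, covD c (cfg U) φ b = 0) :
    ∀ (k : ℕ), j + k ≤ P.m + P.K → (∀ y : Balaban1983to89.Site P (j+k), qCovK U k φ y = 0) → φ = 0
  | 0, _, hQ => funext hQ
  | k + 1, hk, hQ => by
    have hk' : j + k + 1 ≤ P.m + P.K := by omega
    have hcov : ∀ b : PBond P j, toC (U b) * φ b.tgt = φ b.src := fun b => (covD_eq_zero_iff hc (cfg U) φ b).1 (hD b)
    have ht := transport_qCovK hcov k (by omega)
    have hψ : qCovK U k φ = 0 :=
      eq_zero_of_covD_eq_zero_of_qCov_eq_zero hk' one_ne_zero (U := lineIter U k) (φ := qCovK U k φ)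
        (fun b => (covD_eq_zero_iff one_ne_zero (cfg (lineIter U k)) _ b).2 (ht b)) hQ
    exact eq_zero_of_covD_eq_zero_of_qCovK_eq_zero hc hD k (by omega) fun y => congrFun hψ y

/-! ## §2 `hpos` discharged at level `k`; (4.6.1)/(4.6.2), the minimizer ψ_k, (3.28), (4.6.4) for the printed `Q_k(u)` -/

/-- **The convergence condition of (4.6.1) HOLDS at every level `k` on the torus**: for every `U(1)` gauge field `u`, every `a > 0`, `c ≠ 0`
and `j + k ≤ m + K`, `‖D_uφ‖² + a‖Q_k(u)φ‖² > 0` for `φ ≠ 0` (= the hypothesis `hpos` of `BIJ85Eq461Proof.exists_inverse`/`eq461`,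
discharged by §1). [cite: BalabanImbrieJaffe1985, (4.6.2) p.313] -/
theorem hposK_torus {k : ℕ} (hk : j + k ≤ P.m + P.K) {c : ℝ} (hc : c ≠ 0) {a : ℝ} (ha : 0 < a) (U : GaugeField P j U1) :
    ∀ φ : FineSp P j, φ ≠ 0 → 0 < ‖Dlin c U φ‖ ^ 2 + a * ‖QlinK U k φ‖ ^ 2 := by
  intro φ hφ
  have h1 : 0 ≤ ‖Dlin c U φ‖ ^ 2 := by positivity
  have h2 : 0 ≤ a * ‖QlinK U k φ‖ ^ 2 := by positivity
  rcases (add_nonneg h1 h2).lt_or_eq with h | h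
  · exact h
  · exfalso
    have hD0 : ‖Dlin c U φ‖ ^ 2 = 0 := by linarith
    have hQ0 : ‖QlinK U k φ‖ ^ 2 = 0 := by nlinarith
    rw [sq_eq_zero_iff, norm_eq_zero] at hD0 hQ0
    apply hφ
    have hz := eq_zero_of_covD_eq_zero_of_qCovK_eq_zero hc (U := U) (φ := WithLp.ofLp φ)
      (fun b => by rw [← Dlin_apply, hD0, PiLp.zero_apply]) k hk (fun y => by rw [← QlinK_apply, hQ0, PiLp.zero_apply])
    exact (WithLp.ofLp_eq_zero (p := 2)).1 hz

/-- **(4.6.2) at level `k` on the torus: `G_k(u) = [D_u^*D_u + aQ_k(u)^*Q_k(u)]^{−1}` EXISTS** (two-sided inverse), for every gauge field `u`,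
`a > 0`, `c ≠ 0`, `j + k ≤ m + K` — `BIJ85Eq461Proof.exists_inverse` with `hpos` discharged. [cite: BalabanImbrieJaffe1985, (4.6.2) p.313] -/
theorem exists_GK {k : ℕ} (hk : j + k ≤ P.m + P.K) {c : ℝ} (hc : c ≠ 0) {a : ℝ} (ha : 0 < a) (U : GaugeField P j U1) :
    ∃ G : FineSp P j →ₗ[ℝ] FineSp P j,
      (∀ φ, opT (Dlin c U) (QlinK U k) a (G φ) = φ) ∧ ∀ φ, G (opT (Dlin c U) (QlinK U k) a φ) = φ :=
  exists_inverse (Dlin c U) (QlinK U k) a (hposK_torus hk hc ha U)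

/-- kernel: at `k = 1` this is gen 2's `exists_G` verbatim (`QlinK U 1 = Qlin U`). [cite: BalabanImbrieJaffe1985, (4.6.2) p.313] -/
theorem exists_GK_one (hj : j + 1 ≤ P.m + P.K) {c : ℝ} (hc : c ≠ 0) {a : ℝ} (ha : 0 < a) (U : GaugeField P j U1) :
    ∃ G : FineSp P j →ₗ[ℝ] FineSp P j,
      (∀ φ, opT (Dlin c U) (Qlin U) a (G φ) = φ) ∧ ∀ φ, G (opT (Dlin c U) (Qlin U) a φ) = φ := by
  rw [← QlinK_one]
  exact exists_GK hj hc ha U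

/-- **(4.6.1) at level `k` on the torus, no hypothesis left**: for every gauge field `u`, `a > 0`, `c ≠ 0`, `j + k ≤ m + K` and THE inverse
`G_k` of (4.6.2), `exp(½⟨h, G_kh⟩) = Z_k^{−1}∫𝒟φ exp[−½‖D_uφ‖² − ½a‖Q_k(u)φ‖² + ⟨φ, h⟩]` — `BIJ85Eq461Proof.eq461` with `hpos` discharged.
[cite: BalabanImbrieJaffe1985, (4.6.1) p.313] -/
theorem eq461_torusK {k : ℕ} (hk : j + k ≤ P.m + P.K) {c : ℝ} (hc : c ≠ 0) {a : ℝ} (ha : 0 < a) (U : GaugeField P j U1)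
    (G : FineSp P j →ₗ[ℝ] FineSp P j) (hG : ∀ φ, opT (Dlin c U) (QlinK U k) a (G φ) = φ) (h : FineSp P j) :
    Real.exp ((1 / 2 : ℝ) * ⟪h, G h⟫)
      = (∫ φ : FineSp P j, Real.exp (-(1 / 2 : ℝ) * ‖Dlin c U φ‖ ^ 2 - (1 / 2 : ℝ) * a * ‖QlinK U k φ‖ ^ 2))⁻¹ *
        ∫ φ : FineSp P j, Real.exp (-(1 / 2 : ℝ) * ‖Dlin c U φ‖ ^ 2 - (1 / 2 : ℝ) * a * ‖QlinK U k φ‖ ^ 2 + ⟪φ, h⟫) :=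
  eq461 (Dlin c U) (QlinK U k) a (hposK_torus hk hc ha U) G hG h

/-- **p. 313: `ψ_k = a_kG_k(u_k)Q_k^*(u_k)ψ` is THE η-lattice minimizer**, at level `k` on the torus: for every gauge field `u`, `a > 0`, `c ≠ 0`,
`j + k ≤ m + K` and the inverse `G_k` of (4.6.2), `phiCl` (= aG_kQ_k(u)^*ψ) minimizes the printed form ½aΣ|Q_k(u)φ − ψ|² + ½Σ|D_uφ|² over
all φ AND is its only minimizer (`BIJ85ScalarForm464.isMinOn_phiCl` + `eq_phiCl_of_isMinOn`, `hpos` discharged). [cite: BalabanImbrieJaffe1985, (4.6.4) p.313] -/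
theorem isMinOn_psiK_torusK {k : ℕ} (hk : j + k ≤ P.m + P.K) {c : ℝ} (hc : c ≠ 0) {a : ℝ} (ha : 0 < a) (U : GaugeField P j U1)
    {G : FineSp P j →ₗ[ℝ] FineSp P j} (hG : ∀ φ, opT (Dlin c U) (QlinK U k) a (G φ) = φ) (ψ : CoarseSpK P j k) :
    IsMinOn (scalarForm (Dlin c U) (QlinK U k) a ψ) Set.univ (phiCl (QlinK U k) a G ψ) ∧
      ∀ φ, IsMinOn (scalarForm (Dlin c U) (QlinK U k) a ψ) Set.univ φ → φ = phiCl (QlinK U k) a G ψ :=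
  ⟨isMinOn_phiCl hG ha.le ψ, fun _ hmin => eq_phiCl_of_isMinOn hG (hposK_torus hk hc ha U) hmin⟩

/-- **(3.28) at level `k` on the torus** for the printed `Q_k(u)`, `D_u`: the form at φ_cl + φ_fl splits as ½⟨φ_fl, G_k^{−1}φ_fl⟩ +
½a⟨ψ, [I − aQ_kG_kQ_k^*]ψ⟩ (`BIJ85ScalarForm464.eq328`; any right inverse `G_k`). [cite: BalabanImbrieJaffe1985, (3.28) p.308] -/
theorem eq328_torusK (c a : ℝ) (U : GaugeField P j U1) (k : ℕ) {G : FineSp P j →ₗ[ℝ] FineSp P j}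
    (hG : ∀ φ, opT (Dlin c U) (QlinK U k) a (G φ) = φ) (ψ : CoarseSpK P j k) (χ : FineSp P j) :
    scalarForm (Dlin c U) (QlinK U k) a ψ (phiCl (QlinK U k) a G ψ + χ)
      = (1 / 2 : ℝ) * ⟪χ, opT (Dlin c U) (QlinK U k) a χ⟫
        + (1 / 2 : ℝ) * a * ⟪ψ, ((LinearMap.id : CoarseSpK P j k →ₗ[ℝ] CoarseSpK P j k)
            - a • (QlinK U k ∘ₗ G ∘ₗ (QlinK U k).adjoint)) ψ⟫ :=
  eq328 hG ψ χ

/-- **(4.6.4) at level `k` on the torus, Gaussian form with the PRINTED exponent**: `∫𝒟φ exp[−½aΣ_y|(Q_k(u)φ)(y) − ψ(y)|² − ½Σ_b|c(u_bφ(b₊) −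
φ(b₋))|²] = exp(−½⟨ψ, Δ_k(u)ψ⟩)·∫𝒟φ exp(−½⟨φ, G_k^{−1}φ⟩)`, `Δ_k(u) = aI − a²Q_k(u)G_kQ_k(u)^*` (`BIJ85ScalarForm464.deltaOp`) — *"The quadratic
form which arises for the scalar field is ⟨ψ, Δ_k(u_k)ψ⟩"*. [cite: BalabanImbrieJaffe1985, (4.6.4) p.313] -/
theorem eq464_torusK (c a : ℝ) (U : GaugeField P j U1) (k : ℕ) {G : FineSp P j →ₗ[ℝ] FineSp P j}
    (hG : ∀ φ, opT (Dlin c U) (QlinK U k) a (G φ) = φ) (ψ : CoarseSpK P j k) :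
    ∫ φ : FineSp P j, Real.exp (-((1 / 2 : ℝ) * a * (∑ y : Balaban1983to89.Site P (j+k), ‖qCovK U k (WithLp.ofLp φ) y - ψ y‖ ^ 2)
        + (1 / 2 : ℝ) * ∑ b : PBond P j, ‖(c : ℂ) * (toC (U b) * φ b.tgt - φ b.src)‖ ^ 2))
      = Real.exp (-((1 / 2 : ℝ) * ⟪ψ, deltaOp (QlinK U k) a G ψ⟫))
        * ∫ φ : FineSp P j, Real.exp (-((1 / 2 : ℝ) * ⟪φ, opT (Dlin c U) (QlinK U k) a φ⟫)) := by
  simp_rw [← scalarForm_torusK]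
  exact eq464_gaussian hG ψ

/-- **(4.6.4), the infimum, at level `k` on the torus**: `½⟨ψ, Δ_k(u)ψ⟩ ≤ ½aΣ|Q_k(u)φ − ψ|² + ½Σ|D_uφ|²` for all φ, `a ≥ 0`
(`BIJ85ScalarForm464.eq464_inf`). [cite: BalabanImbrieJaffe1985, (4.6.4) p.313] -/
theorem eq464_inf_torusK (c : ℝ) {a : ℝ} (ha : 0 ≤ a) (U : GaugeField P j U1) (k : ℕ) {G : FineSp P j →ₗ[ℝ] FineSp P j}
    (hG : ∀ φ, opT (Dlin c U) (QlinK U k) a (G φ) = φ) (ψ : CoarseSpK P j k) (φ : FineSp P j) :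
    (1 / 2 : ℝ) * ⟪ψ, deltaOp (QlinK U k) a G ψ⟫
      ≤ (1 / 2 : ℝ) * a * (∑ y : Balaban1983to89.Site P (j+k), ‖qCovK U k (WithLp.ofLp φ) y - ψ y‖ ^ 2)
        + (1 / 2 : ℝ) * ∑ b : PBond P j, ‖(c : ℂ) * (toC (U b) * φ b.tgt - φ b.src)‖ ^ 2 := by
  rw [← scalarForm_torusK]
  exact eq464_inf hG ha ψ φ

/-! ## §3 (6.3.2) for the explicit scalar quadratic forms at level `k`: the exponent of (4.6.1) and `⟨ψ, Δ_k(u_k)ψ⟩` are gauge invariant -/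

/-- (2.7) on the `η`-lattice covariant derivative, in `ℂ`: `(D_{u^h}(hφ))_b = h(b₋)·(D_uφ)_b` (exact; `u^h_b = h(b₋)u_bh(b₊)^{−1}`).
[cite: BalabanImbrieJaffe1985, (2.7) p.303] -/
theorem covD_gaugeAct (c : ℝ) (h : GaugeTransf P j U1) (U : GaugeField P j U1) (φ : HiggsField P j) (b : PBond P j) :
    covD c (cfg (GaugeField.gaugeAct h U)) (fun x => toC (h x) * φ x) b = toC (h b.src) * covD c (cfg U) φ b := by
  show (c : ℂ) * (toC (GaugeField.gaugeAct h U b) * (toC (h b.tgt) * φ b.tgt) - toC (h b.src) * φ b.src)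
      = toC (h b.src) * ((c : ℂ) * (toC (U b) * φ b.tgt - φ b.src))
  rw [toC_gaugeAct]
  have := toC_ne_zero (h b.tgt)
  field_simp

/-- **The exponent of (4.6.1)/(6.3.3) is GAUGE INVARIANT at every level `k`**: `½aΣ_y|(Q_k(u^h)(hφ))(y) − h(y)ψ(y)|² +
½Σ_b|c(D_{u^h}(hφ))_b|² = ½aΣ_y|(Q_k(u)φ)(y) − ψ(y)|² + ½Σ_b|c(D_uφ)_b|²`, the unit-lattice transformation `h` being read at the corner
points ((2.8)_k `qCovK_gaugeAct` and `covD_gaugeAct`, `|h| = 1`; standing range `j + k ≤ m + K`) — the mechanism of (6.3.2) *"it is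
clear in the case of the quadratic forms for which we write explicit formulas"* for the scalar form. [cite: BalabanImbrieJaffe1985, (6.3.2) p.320] -/
theorem scalarForm_gaugeAct {k : ℕ} (hk : j + k ≤ P.m + P.K) (c a : ℝ) (h : GaugeTransf P j U1) (U : GaugeField P j U1)
    {ψ ψ' : CoarseSpK P j k} (hψ' : ∀ y, ψ' y = toC (h (cornerIter k y)) * ψ y) (φ : FineSp P j) :
    scalarForm (Dlin c (GaugeField.gaugeAct h U)) (QlinK (GaugeField.gaugeAct h U) k) a ψ'
        (WithLp.toLp 2 fun x => toC (h x) * φ x)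
      = scalarForm (Dlin c U) (QlinK U k) a ψ φ := by
  rw [scalarForm_torusK, scalarForm_torusK]
  congr 1
  · congr 1
    refine sum_congr rfl fun y _ => ?_
    rw [hψ', show qCovK (GaugeField.gaugeAct h U) k (WithLp.ofLp (WithLp.toLp 2 fun x => toC (h x) * φ x)) y
        = toC (h (cornerIter k y)) * qCovK U k (WithLp.ofLp φ) y from qCovK_gaugeAct h U (WithLp.ofLp φ) k hk y,
      ← mul_sub, norm_mul, norm_toC, one_mul]
  · congr 1
    refine sum_congr rfl fun b _ => ?_
    have e : (c : ℂ) * (toC (GaugeField.gaugeAct h U b) * (toC (h b.tgt) * φ b.tgt) - toC (h b.src) * φ b.src)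
        = toC (h b.src) * ((c : ℂ) * (toC (U b) * φ b.tgt - φ b.src)) :=
      covD_gaugeAct c h U (WithLp.ofLp φ) b
    show ‖(c : ℂ) * (toC (GaugeField.gaugeAct h U b) * (toC (h b.tgt) * φ b.tgt) - toC (h b.src) * φ b.src)‖ ^ 2 = _
    rw [e, norm_mul, norm_toC, one_mul]

/-- **(6.3.2) FOR THE SCALAR QUADRATIC FORM `⟨ψ, Δ_k(u_k)ψ⟩` AT EVERY LEVEL `k`**, verbatim p. 320: *"Our procedure for constructing S_k has
the general invariance S_k(u_ke^{−iη∂λ}, e^{iλ}φ) = S_k(u_k, φ) (6.3.2) for a gauge transformation λ. While we do not prove this invariance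
here, it is clear in the case of the quadratic forms for which we write explicit formulas."* — PROVED for the explicit scalar form (4.6.4)
on the torus: `⟨hψ, Δ_k(u^h)hψ⟩ = ⟨ψ, Δ_k(u)ψ⟩` for every `U(1)` gauge field `u`, every gauge transformation `h` of the `η`-lattice (read at
the corner points on the unit lattice), `a ≥ 0`, and any right inverses `G_k`, `G′_k` of the two operators `D^*D + aQ_k^*Q_k` (by the
infimum characterization (4.6.4): `½⟨ψ, Δ_kψ⟩ = min_φ` of the invariant exponent, `φ ↦ hφ` bijective). [cite: BalabanImbrieJaffe1985, (6.3.2) p.320] -/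
theorem inner_deltaOp_gaugeAct {k : ℕ} (hk : j + k ≤ P.m + P.K) (c : ℝ) {a : ℝ} (ha : 0 ≤ a) (h : GaugeTransf P j U1)
    (U : GaugeField P j U1) {G G' : FineSp P j →ₗ[ℝ] FineSp P j} (hG : ∀ φ, opT (Dlin c U) (QlinK U k) a (G φ) = φ)
    (hG' : ∀ φ, opT (Dlin c (GaugeField.gaugeAct h U)) (QlinK (GaugeField.gaugeAct h U) k) a (G' φ) = φ)
    {ψ ψ' : CoarseSpK P j k} (hψ' : ∀ y, ψ' y = toC (h (cornerIter k y)) * ψ y) :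
    ⟪ψ', deltaOp (QlinK (GaugeField.gaugeAct h U) k) a G' ψ'⟫ = ⟪ψ, deltaOp (QlinK U k) a G ψ⟫ := by
  have k1 := scalarForm_phiCl hG' ψ'
  have k2 := scalarForm_phiCl hG ψ
  apply le_antisymm
  · have h1 := eq464_inf hG' ha ψ' (WithLp.toLp 2 fun x => toC (h x) * (phiCl (QlinK U k) a G ψ) x)
    rw [scalarForm_gaugeAct hk c a h U hψ' (phiCl (QlinK U k) a G ψ), k2] at h1
    linarith
  · set χ : FineSp P j := phiCl (QlinK (GaugeField.gaugeAct h U) k) a G' ψ' with hχ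
    have h2 := eq464_inf hG ha ψ (WithLp.toLp 2 fun x => (toC (h x))⁻¹ * χ x)
    have e : (WithLp.toLp 2 fun x => toC (h x) * (WithLp.toLp 2 fun x => (toC (h x))⁻¹ * χ x : FineSp P j) x) = χ := by
      ext x
      show toC (h x) * ((toC (h x))⁻¹ * χ x) = χ x
      rw [mul_inv_cancel_left₀ (toC_ne_zero (h x))]
    rw [← scalarForm_gaugeAct hk c a h U hψ' (WithLp.toLp 2 fun x => (toC (h x))⁻¹ * χ x), e, k1] at h2
    linarith

end

end Literature.MathematicalPhysics.QuantumFieldTheory.BalabanImbrieJaffe1984to88.BIJ85ScalarPropagatorTorusK
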